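import Summits.ResolutionOfSingularities.ResolutionOfSingularities.Theorems.MonomialBlowupLU3
import Summits.ResolutionOfSingularities.ResolutionOfSingularities.Theorems.TameTwoStoreyLU8
import HarnessLib

/-!
# MonomialBlowupLU4 — the located residual R31, the exact cuts `R30 ↔ R31 ↔ R29 ↔ R28 ↔ R25 ↔ R23`, ROOT BY NAME `closes_mb`

One of the four landing files of the g30 node «MonomialBlowup» of the ROOT/RESIDUAL decomposition cell `decomp-res`
(lens 1; Door B of NEXT-g30, critic rows 207 / 223 / 223c; files `MonomialBlowupLU`, `…LU2`, `…LU3`, `…LU4`); see the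
module docstring of `Summits.ResolutionOfSingularities.ResolutionOfSingularities.Theorems.MonomialBlowupLU` for the thesis ([CossartPiltant2008,
Prop. 9.3] LAYER 3 in every dimension), the cell `MonomialBlowupAbove k O` and the law
`quasiFiniteLUAbove_of_monomialBlowupAbove : MonomialBlowupAbove k O → QuasiFiniteLUAbove k O` (in `…LU3`), the
costume diff, the paper instance and the sources.  This file: PART C — `NonKHToricArchLUKeyHenselDescentQuotTInertTwoMBCell` (`_holds`), R31 `NonKHToricArchLUKeyHenselDescentQuotTInertTwoMB` (docstring = the honest located remainder), `…TInertTwoMB_of_tame2` (R30 → R31), THE CUT `nonKHToricArchLUKeyHenselDescentQuotTInertTwo_iff_mb` (R30 ↔ R31) and `…TInertTwo_of_mb` (no case split), the re-locations `…334_iff_mb`, `…QuotTInert_iff_mb` (R29), `…QuotInert_iff_mb` (R28), `…Quot_iff_mb` (R25), `nonKHToricArchLUKeyHenselDescent_iff_mb` (R23), `nonKHToricArchLU_iff_mb`, `…MB_of_root`, `closes_mb`, `root_iff_mb_sigma`.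
Imports: `…MonomialBlowupLU3` and the landed `…TameTwoStoreyLU8`.  Problem side, sorry-free, hypothesis-free (zero fact binders); every heavy theorem carries
`set_option maxHeartbeats … in` BEFORE its docstring — keep it.
-/

noncomputable section

open IsLocalRing Polynomial IntermediateField Literature.AlgebraicGeometry.Resolution
open Summit.ResolutionOfSingularities.ResolutionOfSingularities.Theorems.DecompositionDescentLU
open scoped Pointwise

namespace Summit.ResolutionOfSingularities.ResolutionOfSingularities.Theorems.MonomialBlowupLU

universe u


/-! ## PART C — the located residual `R31`, the exact cuts `R30 ↔ R31 ↔ R29 ↔ R28 ↔ R25 ↔ R23`, ROOT BY NAME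
`closes_mb` -/

section CutMB

variable {k K : Type} [Field k] [Field K] [Algebra k K]

open Summit.ResolutionOfSingularities.ResolutionOfSingularities.Theses
open Summit.ResolutionOfSingularities.ResolutionOfSingularities.Theorems
open Summit.ResolutionOfSingularities.ResolutionOfSingularities.Theorems.KeyChainLU
open Summit.ResolutionOfSingularities.ResolutionOfSingularities.Theorems.HenselKeyChainLU
open Summit.ResolutionOfSingularities.ResolutionOfSingularities.Theorems.GaloisDescentLU
open Summit.ResolutionOfSingularities.ResolutionOfSingularities.Theorems.PfaffLine
open Summit.ResolutionOfSingularities.ResolutionOfSingularities.Theorems.ToricLadder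
open Summit.ResolutionOfSingularities.ResolutionOfSingularities.Theorems.KaplanskyLadder
open Summit.ResolutionOfSingularities.ResolutionOfSingularities.Theorems.PerronLadder
open Summit.ResolutionOfSingularities.ResolutionOfSingularities.Theorems.DefectlessLadder
open Summit.ResolutionOfSingularities.ResolutionOfSingularities.Theorems.WCut
open Summit.ResolutionOfSingularities.ResolutionOfSingularities.Theorems.TameQuotientLU
open Summit.ResolutionOfSingularities.ResolutionOfSingularities.Theorems.DecompositionDescentLU
open Summit.ResolutionOfSingularities.ResolutionOfSingularities.Theorems.InertDescentLU
open Summit.ResolutionOfSingularities.ResolutionOfSingularities.Theorems.TameInertialLU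
open Summit.ResolutionOfSingularities.ResolutionOfSingularities.Theorems.TameTwoStoreyLU

/-- The MONOMIAL-BLOW-UP CELL PIECE of the residual family (tag DECIDED by `relLU_of_monomialBlowupAbove`):
R30's binders together with the monomial-blow-up cell give relative local uniformization. -/
def NonKHToricArchLUKeyHenselDescentQuotTInertTwoMBCell (e c n : ℕ) : Prop :=
  ∀ p : ℕ, p.Prime → ∀ (k K : Type) [Field k] [CharP k p] [Field K] [Algebra k K],
    Algebra.trdeg k K ≤ n → ∀ O : ValuationSubring K, Nonempty O.valuation.RankOne →
    (∀ y ∈ O, ∃ f : Polynomial k, f ≠ 0 ∧ Polynomial.aeval y f ∈ O.nonunits) →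
    ¬ IsAbhyankarPlace O (algebraMap k K).fieldRange ⊤ →
    ¬ (∃ d : ℕ, d < n ∧ SepDenseBelow k O d) → ¬ ToricDenseBelow k O e → ¬ KHTopBelow k O c →
    ¬ KeyChainTopBelow k O → ¬ HenselKeyChainTopBelow k O → ¬ GaloisHenselDescentDatum k O →
    ¬ TameQuotientLU.TameEquivariantLUAbove k O →
    ¬ DecompositionFieldLUAbove k O → ¬ DecWitnessLUAbove k O → ¬ UnramifiedWitnessLUAbove k O →
    ¬ TameInertialLUAbove k O → ¬ TameOverInertLUAbove k O →
    MonomialBlowupAbove k O → RelLocalUniformization k K O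

/-- THE COMPOSITE LAW (layers 3 ∘ 2 ∘ 1) DECIDES THE CELL PIECE outright (no port, no fact binder). [folklore] -/
theorem nonKHToricArchLUKeyHenselDescentQuotTInertTwoMBCell_holds (e c n : ℕ) :
    NonKHToricArchLUKeyHenselDescentQuotTInertTwoMBCell e c n :=
  fun _ _ _ _ _ _ _ _ _ _ _ _ _ _ _ _ _ _ _ _ _ _ _ _ _ hm => relLU_of_monomialBlowupAbove hm

/-- **NEW LOCATED RESIDUAL `R31`** (tag UNDECIDED · WEAKER than the root · located at `(e, c, n) = (3, 3, 4)`):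
the located residual OFF the key-chain, Hensel, descent, tame-quotient, decomposition-descent, residue-free
witness, tame-inertial, two-storey AND MONOMIAL-BLOW-UP cells — in addition to R30's clauses, for NO valuation ring
`O_E` of `K̄` above `O` with residues algebraic over `k`, NO Hensel root `η ∈ O_E` over `O` with `K`-rational
residue and NO layer `K ≤ K′ ≤ K(η)` does EVERY normal affine model `k[t₁] ⊆ O` of `K`, with integral closure
`k[t₁ ∪ t₁′]` in `K′`, admit above its local ring `R₁′` a model `k[t′] ⊆ O_E` of `K′`, REGULAR at the centre, with
regular parameters `x₀ … x_{d-1}`, `0 < r ≤ d`, (a) `𝔪_{R₁′}S′ ⊆ (x₀⋯x_{r-1})S′`, (b) `K`-functions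
`fᵢ = γᵢ ∏ xⱼ^{aᵢⱼ}` (`i < r`) with `det(aᵢⱼ) ≠ 0`, (c) `f ∈ R₁′`, a unit times a monomial in `x_{<r}`, with
`k[t′] ⊆ R₁′[1/f]` ([CossartPiltant2008, Prop. 8.1 (1)–(2) + (46)]).  KIND CONSUMED (hypothesis-free, by
`relLU_of_monomialBlowupAbove` = layer 3 `quasiFiniteLUAbove_of_monomialBlowupAbove` ∘ the landed layers 2–1
`relLU_of_quasiFiniteLUAbove`): [CoP1] Prop. 9.3's THIRD layer — "from a monomial blow-up upstairs (the OUTPUT of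
Prop. 8.1) to the quasi-finite regular model `S″` cut out by `K`-functions `F₁…F_r, H_{r+1}…H_d`" ((46)–(52):
adjugate monomials `Fᵢ := ∏ⱼ fⱼ^{bᵢⱼ} = δᵢ xᵢ^h`, density of `R₁` in `R₁′` (44), `Hⱼ := (hⱼ − P_{j,C}(F))/G_{j,C}`
with `Hⱼ S′ = xⱼ S′`, `√((F,H)) = 𝔪_{S′}`) — in EVERY dimension `d` and for EVERY degree `[K′ : K]`.  HONEST
SCOPE OF THE CUT: the extra binder `¬ MonomialBlowupAbove k O` is IMPLIED by R30's `¬ DecompositionFieldLUAbove k O`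
(`not_monomialBlowupAbove_of_not_decompositionFieldLUAbove`, layers 3 + 2), exactly as R27 already carried
`¬ QuasiFiniteLUAbove` for free: the CLASS of places in R31 is the class of R30 — what moved is the LOCATION of the
difficulty, now three layers up: after R31 the decomposition-descent door asks only for the OUTPUT OF A MONOMIAL
BLOW-UP UPSTAIRS (an embedded principalization `(S₀)_f = S_f`, `√(fS) = (x₁⋯x_r)` above a normal model in a finite
Hensel layer), no longer for a quasi-finite model, a local uniformization read downstairs, or `K`-functions cutting
out the closed point.  HONEST LOCATED REMAINDER (which `O` remain — the class is NOT empty): (B′) places of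
`trdeg ≥ 4` for which no finite Hensel layer `K′` carries a monomial blow-up above every normal model — producing one
from a local uniformization of `(K′, O_E ∩ K′)` is [CoP1] Prop. 4.1 (embedded monomialization of an ideal in a
REGULAR variety of dimension `d`), in print for `d = 3` only (there inside the floor `CossartPiltant2019LU3`),
Hironaka-strength and OPEN for `d ≥ 4` in characteristic `p` — IDEA-NEEDED, not claimed; (α3′) the split storey,
(β) wild ramification `G_W ≠ 1`, (γ) the defect / immediate world, as located in R30's docstring; and, orthogonally,
the PRODUCTION of regular models upstairs (every relative cell's model clause is an INPUT). -/
def NonKHToricArchLUKeyHenselDescentQuotTInertTwoMB (e c n : ℕ) : Prop :=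
  ∀ p : ℕ, p.Prime → ∀ (k K : Type) [Field k] [CharP k p] [Field K] [Algebra k K],
    Algebra.trdeg k K ≤ n → ∀ O : ValuationSubring K, Nonempty O.valuation.RankOne →
    (∀ y ∈ O, ∃ f : Polynomial k, f ≠ 0 ∧ Polynomial.aeval y f ∈ O.nonunits) →
    ¬ IsAbhyankarPlace O (algebraMap k K).fieldRange ⊤ →
    ¬ (∃ d : ℕ, d < n ∧ SepDenseBelow k O d) → ¬ ToricDenseBelow k O e → ¬ KHTopBelow k O c →
    ¬ KeyChainTopBelow k O → ¬ HenselKeyChainTopBelow k O → ¬ GaloisHenselDescentDatum k O →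
    ¬ TameQuotientLU.TameEquivariantLUAbove k O →
    ¬ DecompositionFieldLUAbove k O → ¬ DecWitnessLUAbove k O → ¬ UnramifiedWitnessLUAbove k O →
    ¬ TameInertialLUAbove k O → ¬ TameOverInertLUAbove k O →
    ¬ MonomialBlowupAbove k O → RelLocalUniformization k K O

/-- Dropping the negated monomial-blow-up hypothesis: `R30 → R31`. [folklore] -/
theorem nonKHToricArchLUKeyHenselDescentQuotTInertTwoMB_of_tame2 {e c n : ℕ}
    (h : NonKHToricArchLUKeyHenselDescentQuotTInertTwo e c n) :
    NonKHToricArchLUKeyHenselDescentQuotTInertTwoMB e c n :=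
  fun p hp k K _ _ _ _ hd O h1 h0 hA hnd hnt hnk hkey hH hG hT hDF hDW hU hI h2 _ =>
    h p hp k K hd O h1 h0 hA hnd hnt hnk hkey hH hG hT hDF hDW hU hI h2

/-- **THE MONOMIAL-BLOW-UP CUT** (kernel, exact, hypothesis-free): the g29 located residual `R30` is EQUIVALENT
to its part off the monomial-blow-up cell — on the cell the composite law `relLU_of_monomialBlowupAbove` decides
(case split on `MonomialBlowupAbove k O`). [folklore] -/
theorem nonKHToricArchLUKeyHenselDescentQuotTInertTwo_iff_mb {e c n : ℕ} :
    NonKHToricArchLUKeyHenselDescentQuotTInertTwo e c n ↔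
      NonKHToricArchLUKeyHenselDescentQuotTInertTwoMB e c n := by
  refine ⟨nonKHToricArchLUKeyHenselDescentQuotTInertTwoMB_of_tame2,
    fun h p hp k K _ _ _ _ hd O hr hz hA hnd hnt hnk hkey hH hG hT hDF hDW hU hI h2 => ?_⟩
  by_cases hm : MonomialBlowupAbove k O
  · exact relLU_of_monomialBlowupAbove hm
  exact h p hp k K hd O hr hz hA hnd hnt hnk hkey hH hG hT hDF hDW hU hI h2 hm

/-- The same cut WITHOUT a case split: R31's extra binder is implied by R30's `¬ DecompositionFieldLUAbove`
(layers 3 + 2, `not_monomialBlowupAbove_of_not_decompositionFieldLUAbove`) — the honest reading of the cut: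
the class of places did not shrink, the difficulty was re-located three layers up. [folklore] -/
theorem nonKHToricArchLUKeyHenselDescentQuotTInertTwo_of_mb {e c n : ℕ}
    (h : NonKHToricArchLUKeyHenselDescentQuotTInertTwoMB e c n) :
    NonKHToricArchLUKeyHenselDescentQuotTInertTwo e c n :=
  fun p hp k K _ _ _ _ hd O hr hz hA hnd hnt hnk hkey hH hG hT hDF hDW hU hI h2 =>
    h p hp k K hd O hr hz hA hnd hnt hnk hkey hH hG hT hDF hDW hU hI h2
      (not_monomialBlowupAbove_of_not_decompositionFieldLUAbove hDF)

/-- The EXACT re-location at the programme's parameters `(3, 3, 4)` (`R30 ↔ R31`, hypothesis-free). [folklore] -/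
theorem nonKHToricArchLUKeyHenselDescentQuotTInertTwo334_iff_mb :
    NonKHToricArchLUKeyHenselDescentQuotTInertTwo 3 3 4 ↔
      NonKHToricArchLUKeyHenselDescentQuotTInertTwoMB 3 3 4 :=
  nonKHToricArchLUKeyHenselDescentQuotTInertTwo_iff_mb

/-- The g28 located residual `R29` re-located in one step (`R29 ↔ R31`). [folklore] -/
theorem nonKHToricArchLUKeyHenselDescentQuotTInert_iff_mb {e c n : ℕ} :
    NonKHToricArchLUKeyHenselDescentQuotTInert e c n ↔ NonKHToricArchLUKeyHenselDescentQuotTInertTwoMB e c n :=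
  nonKHToricArchLUKeyHenselDescentQuotTInert_iff_tame2.trans nonKHToricArchLUKeyHenselDescentQuotTInertTwo_iff_mb

/-- The g28 located residual `R28` re-located (`R28 ↔ R31`). [folklore] -/
theorem nonKHToricArchLUKeyHenselDescentQuotInert_iff_mb {e c n : ℕ} :
    NonKHToricArchLUKeyHenselDescentQuotInert e c n ↔ NonKHToricArchLUKeyHenselDescentQuotTInertTwoMB e c n :=
  nonKHToricArchLUKeyHenselDescentQuotInert_iff_tame2.trans nonKHToricArchLUKeyHenselDescentQuotTInertTwo_iff_mb

/-- The g25 located residual re-located (`R25 ↔ R31`). [folklore] -/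
theorem nonKHToricArchLUKeyHenselDescentQuot_iff_mb {e c n : ℕ} :
    NonKHToricArchLUKeyHenselDescentQuot e c n ↔ NonKHToricArchLUKeyHenselDescentQuotTInertTwoMB e c n :=
  nonKHToricArchLUKeyHenselDescentQuot_iff_tame2.trans nonKHToricArchLUKeyHenselDescentQuotTInertTwo_iff_mb

/-- The g23 located residual re-located (`R23 ↔ R31`). [folklore] -/
theorem nonKHToricArchLUKeyHenselDescent_iff_mb {e c n : ℕ} :
    NonKHToricArchLUKeyHenselDescent e c n ↔ NonKHToricArchLUKeyHenselDescentQuotTInertTwoMB e c n :=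
  nonKHToricArchLUKeyHenselDescent_iff_tame2.trans nonKHToricArchLUKeyHenselDescentQuotTInertTwo_iff_mb

/-- The TRUE residual family of g17/g20 (`NonKHToricArchLU`) re-located off all nine cells. [folklore] -/
theorem nonKHToricArchLU_iff_mb {e c n : ℕ} :
    NonKHToricArchLU e c n ↔ NonKHToricArchLUKeyHenselDescentQuotTInertTwoMB e c n :=
  nonKHToricArchLU_iff_tame2.trans nonKHToricArchLUKeyHenselDescentQuotTInertTwo_iff_mb

/-- The new residual follows from the root outright (it is a WEAKER piece). [folklore] -/
theorem nonKHToricArchLUKeyHenselDescentQuotTInertTwoMB_of_root (hS : _root_.ResolutionOfSingularities)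
    (e c n : ℕ) : NonKHToricArchLUKeyHenselDescentQuotTInertTwoMB e c n :=
  nonKHToricArchLUKeyHenselDescentQuotTInertTwoMB_of_tame2
    (nonKHToricArchLUKeyHenselDescentQuotTInertTwo_of_root hS e c n)

/-- **`closes_mb` — ROOT BY NAME (binders PRINTED, = `closes_tame2`'s with `R30 ↦ R31`):**
`(hCP : CossartPiltant2019LU3)` the Cossart–Piltant dimension-3 floor (print) ·
`(hCJS : CossartJannsenSaito2020Embedded)` embedded resolution of excellent surfaces (named fact) ·
`(hAsc : KK05NCVAscent)` the Knaf–Kuhlmann (NC)+(V) ascent Π₁ (print) · `(hN : ∀ d ≥ 4, R31 3 3 d)` the located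
residual OFF the key-chain, Hensel, descent, tame-quotient, decomposition-descent, residue-free witness,
tame-inertial, two-storey AND monomial-blow-up cells · `(h₃ : Valuative.PatchingRel)` the patching crux 0642 ⇒
`ResolutionOfSingularities`.  All nine cells are discharged INSIDE the kernel. [folklore] -/
theorem closes_mb (hCP : CossartPiltant2019LU3.{0}) (hCJS : CossartJannsenSaito2020Embedded.{0})
    (hAsc : KK05NCVAscent) (hN : ∀ d, 4 ≤ d → NonKHToricArchLUKeyHenselDescentQuotTInertTwoMB 3 3 d)
    (h₃ : Valuative.PatchingRel) : _root_.ResolutionOfSingularities :=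
  closes_tame2 hCP hCJS hAsc (fun d hd => nonKHToricArchLUKeyHenselDescentQuotTInertTwo_iff_mb.2 (hN d hd)) h₃

/-- Root-level summary: modulo floor + CJS + Π₁ + 0642 the ROOT is EQUIVALENT to the residual family off the nine
cells. [folklore] -/
theorem root_iff_mb_sigma (hCP : CossartPiltant2019LU3.{0})
    (hCJS : CossartJannsenSaito2020Embedded.{0}) (hAsc : KK05NCVAscent) (h₃ : Valuative.PatchingRel) :
    _root_.ResolutionOfSingularities ↔ ∀ d, 4 ≤ d → NonKHToricArchLUKeyHenselDescentQuotTInertTwoMB 3 3 d := by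
  rw [root_iff_tame2_sigma hCP hCJS hAsc h₃]
  exact forall₂_congr fun d _ => nonKHToricArchLUKeyHenselDescentQuotTInertTwo_iff_mb

end CutMB

end Summit.ResolutionOfSingularities.ResolutionOfSingularities.Theorems.MonomialBlowupLU

end
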